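import Summits.HubbardSuperconductivity.HubbardSuperconductivity.Theses.LiebTwin
import Summits.HubbardSuperconductivity.HubbardSuperconductivity.Theorems.ThermalWedgeTwSeededEnsembleEquivalenceBarrierEtaTower
import Summits.HubbardSuperconductivity.HubbardSuperconductivity.Theorems.EnslavedA1gPairChemicalPotentialWindowLemmas
import Literature.MathematicalPhysics.QuantumLattice.HubbardRingPerronFrobeniusProofs
import Literature.MathematicalPhysics.QuantumLattice.DopedRVBState
import Literature.MathematicalPhysics.QuantumLattice.SectorSpectrum

/-!
# Crux `NoOnsiteODLRO` (stmt-HubbardSuperconductivity-0933; routes `LiebTwin`, `EnslavedA1g`) —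
# negative-side support: the GROUND-STATE (eigenvector) clause is load-bearing

The crux `Theses.LiebTwin.NoOnsiteODLRO` (= `Theses.EnslavedA1g.NoOnsiteODLRO`) says: for all `U > 0`,
`δ ∈ (0, 1/2)` and every admissible sequence `ψ_L` of normalised `(N_L, S^z = 0)`-sector GROUND STATES of
`hubbardTorus 2 L 1 U`, `N_L = 2⌊(1-δ)L²/2⌋`, the on-site (`k = 0`) pair structure factor
`S_L = Re⟨ψ_L, (pairField sWave L)ᴴ (pairField sWave L) ψ_L⟩` is `o(L⁴)` along even `L`.

This file does NOT refute the crux. It records, as a kernel-checked fact for provers and planners,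
that the conclusion is carried entirely by the eigenvector equation `H ψ_L = E_{N_L} ψ_L` inside
`IsGroundStateInSector`: keep every other clause (the filling `N_L`, normalisation, membership in the
joint sector `szSector N_L 0`, `ψ_L ≠ 0`, the ranges of `U` and `δ`) and drop only that equation, and the
statement becomes FALSE (`noOnsiteODLRO_false_without_groundState`). The witness is Yang's UNSTAGGERED
`η`-tower `ψ_L ∝ (η₀†)^m |0⟩`, `η₀† = Σ_x c†_{x↑} c†_{x↓}` (`etaPairingState 1 m`), `m = N_L/2`: it lies in
the sector `(m, m)`, and since `(pairField sWave L)ᴴ (pairField sWave L) = 2 η₀† η₀` (tree: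
`etaTower_pairField_conjTranspose_mul_self`) and `η₀† η₀ ψ_m = m (L² - m + 1) ψ_m` (tree:
`etaTower_etaRaise_mul_etaLower_mulVec`), the normalised tower state has
`S_L = 2 m (L² - m + 1) ≥ (10/64) L⁴` at `δ = 1/4` — a macroscopic on-site `k = 0` pair condensate
inside the admissible sector. So any proof of the crux must use the spectral (bottom-of-sector)
property of `ψ_L`, not sector bookkeeping; and the `η₀`-tower is the extremiser any `S_L`-bound must beat.

* `isInSector_etaPairingState` — `(η_ε†)^m |0⟩ ∈` Lieb's sector `(m, m)` for every sign `ε`.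
* `pairNumber_mulVec_etaPairingState_one` — `(P_sᴴ P_s) ψ_m = 2 m (L² - m + 1) ψ_m` for the unstaggered tower.
* `re_expect_pairNumber_of_eigen` — `Re⟨ψ, A ψ⟩ = κ` for a unit `ψ` with `A ψ = κ ψ`, `κ ∈ ℝ`.
* `noOnsiteODLRO_false_without_groundState` — the mutated statement (inline, no definition) is false.

Sources: C. N. Yang, PRL **63** (1989) 2144, eqs. (4)–(11) (η pairing, the tower, its pair correlations);
C. N. Yang, S. C. Zhang, Mod. Phys. Lett. B **4** (1990) 759, Theorem 1 and §4 (`⟨ψ_m, η†η ψ_m⟩ = j² - j_z² + j + j_z`);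
D. J. Scalapino, Phys. Rep. **250** (1995) 329, §2 (pair-field order). Elementary; no definition is introduced
(the mutated proposition is spelled inline).
-/

noncomputable section

-- the mandated namespace repeats `HubbardSuperconductivity` (single-problem summit, D-0017)
set_option linter.dupNamespace false

namespace Summit.HubbardSuperconductivity.HubbardSuperconductivity.Theorems.NoOnsiteODLRO.Negative

open Matrix
open Literature.Probability.LatticeModels Literature.MathematicalPhysics.QuantumLattice
open Literature.MathematicalPhysics.QuantumLattice.EtaPairingODLRO (etaPairingState_zero)
open Summit.HubbardSuperconductivity.HubbardSuperconductivity.Theorems.TwSeededEnsembleEquivalence.ExposedDensity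
  (etaTower_pairField_conjTranspose_mul_self etaTower_etaRaise_mul_etaLower_mulVec)
open Summit.HubbardSuperconductivity.HubbardSuperconductivity.Theorems.EnslavedA1g
  (isInSector_mulVec_of_shifts shifts_etaRaise)
open scoped ComplexOrder

/-! ### The `η`-tower lies in Lieb's sector `(m, m)` -/

/-- For every sign `ε`, the tower state `(η_ε†)^m |0⟩` has `m` up and `m` down electrons
(`η†` has grade `(1,1)`, the vacuum grade `(0,0)`). Yang, PRL 63 (1989) 2144, eq. (7). [folklore] -/
theorem isInSector_etaPairingState {Λ : Type*} [LinearOrder Λ] [Fintype Λ] (ε : Λ → ℤˣ) (m : ℕ) :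
    IsInSector m m (etaPairingState ε m) := by
  induction m with
  | zero =>
    rw [etaPairingState_zero]
    exact IsInSector.vacuum
  | succ m ih =>
    rw [etaPairingState_succ]
    exact isInSector_mulVec_of_shifts (shifts_etaRaise ε) (by push_cast; ring) (by push_cast; ring) ih

/-- The unstaggered tower state lies in the joint sector `(N, S^z) = (2m, 0)`. [folklore] -/
theorem etaPairingState_one_mem_szSector (L m : ℕ) :
    etaPairingState (fun _ : FermionTorus 2 L => (1 : ℤˣ)) m ∈
      szSector (Λ := FermionTorus 2 L) (2 * m) 0 :=
  (mem_szSector_two_mul_zero_iff m _).2 (isInSector_etaPairingState _ m)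

/-! ### The on-site pair number on the tower -/

/-- `(P_sᴴ P_s) ψ_m = 2 m (L² - m + 1) ψ_m` for `P_s = pairField sWave L` and the unstaggered tower
`ψ_m = (η₀†)^m |0⟩` on `(ℤ/Lℤ)²` (`P_sᴴ P_s = 2 η₀†η₀`, `η₀†η₀ ψ_m = m(L² - m + 1) ψ_m`).
Yang–Zhang, Mod. Phys. Lett. B 4 (1990) 759, §4. [folklore] -/
theorem pairNumber_mulVec_etaPairingState_one (L : ℕ) [NeZero L] (m : ℕ) :
    ((pairField sWave L)ᴴ * pairField sWave L) *ᵥ etaPairingState (fun _ : FermionTorus 2 L => (1 : ℤˣ)) m =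
      ((2 * (m : ℝ) * ((L : ℝ) ^ 2 - m + 1) : ℝ) : ℂ) •
        etaPairingState (fun _ : FermionTorus 2 L => (1 : ℤˣ)) m := by
  rw [etaTower_pairField_conjTranspose_mul_self, smul_mulVec, etaTower_etaRaise_mul_etaLower_mulVec,
    smul_smul, card_fermionTorus]
  congr 1
  push_cast
  ring

/-- For a unit vector `ψ` with `A ψ = κ ψ`, `κ` real: `Re⟨ψ, A ψ⟩ = κ`. [folklore] -/
theorem re_expect_of_eigen {ι : Type*} [Fintype ι] {A : Matrix (Finset ι) (Finset ι) ℂ}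
    {ψ : Fock ι} {κ : ℝ} (hA : A *ᵥ ψ = (κ : ℂ) • ψ) (hψ : star ψ ⬝ᵥ ψ = 1) :
    (expect A ψ).re = κ := by
  rw [expect, hA, dotProduct_smul, hψ, smul_eq_mul, mul_one, Complex.ofReal_re]

/-! ### The mutation: drop the eigenvector equation, keep everything else -/

/-- The arithmetic of the witness: with `X = L² ≥ 4` and `3X/8 - 1 ≤ m ≤ 3X/8`,
`2 m (X - m + 1) > X²/8`. [folklore] -/
theorem witness_arith {X m : ℝ} (hX : 4 ≤ X) (h1 : 3 * X / 8 - 1 ≤ m) (h2 : m ≤ 3 * X / 8) :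
    X ^ 2 / 8 < 2 * m * (X - m + 1) := by
  nlinarith [mul_nonneg (sub_nonneg.2 h1) (sub_nonneg.2 h2), mul_nonneg (sub_nonneg.2 hX) (sub_nonneg.2 h2),
    mul_nonneg (sub_nonneg.2 hX) (sub_nonneg.2 hX)]

/-- **The eigenvector clause of `NoOnsiteODLRO` is load-bearing.** The negated statement below is the
crux `Theses.LiebTwin.NoOnsiteODLRO` VERBATIM except that `IsGroundStateInSector H (N L) 0 (ψ L)`
(`= ψ L ∈ szSector (N L) 0 ∧ ψ L ≠ 0 ∧ H ψ L = E • ψ L`) is replaced by its first two conjuncts, i.e. the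
eigenvector equation `H ψ_L = E_{N_L} ψ_L` is dropped (so `U` idles). With that clause gone the statement is
FALSE: at
`U = 1`, `δ = 1/4` the normalised unstaggered `η`-tower `ψ_L ∝ (η₀†)^{m_L} |0⟩`, `m_L = ⌊(3/4)L²/2⌋`,
is admissible in this weakened sense and has on-site pair structure factor
`S_L = 2 m_L (L² - m_L + 1) > L⁴/8` at every even `L ≥ 2`, so `S_L / L⁴ ≤ 1/8` fails eventually.
Yang, PRL 63 (1989) 2144, eqs. (7)–(11); Yang–Zhang, Mod. Phys. Lett. B 4 (1990) 759, §4. [folklore] -/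
theorem noOnsiteODLRO_false_without_groundState :
    ¬ (∀ (U δ : ℝ), 0 < U → δ ∈ Set.Ioo (0 : ℝ) (1 / 2) →
        ∀ (N : ℕ → ℕ) (ψ : ∀ L, Fock (Orb (FermionTorus 2 L))),
          (∀ L, Even L → N L = 2 * ⌊(1 - δ) * (L : ℝ) ^ 2 / 2⌋₊ ∧ star (ψ L) ⬝ᵥ ψ L = 1 ∧
              (ψ L ∈ szSector (Λ := FermionTorus 2 L) (N L) 0 ∧ ψ L ≠ 0)) →
            ∀ ε : ℝ, 0 < ε → ∃ L₀ : ℕ, ∀ (L : ℕ) [NeZero L], Even L → L₀ ≤ L →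
              (expect ((pairField sWave L)ᴴ * pairField sWave L) (ψ L)).re / (L : ℝ) ^ 4 ≤ ε) := by
  intro h
  -- pair number `m_L = ⌊(1 - 1/4) L² / 2⌋` and the tower states
  set m : ℕ → ℕ := fun L => ⌊(1 - (1 / 4 : ℝ)) * (L : ℝ) ^ 2 / 2⌋₊ with hm
  have hmle : ∀ L, m L ≤ Fintype.card (FermionTorus 2 L) := fun L => by
    rw [card_fermionTorus]
    refine Nat.floor_le_of_le ?_
    have hL : (0 : ℝ) ≤ (L : ℝ) ^ 2 := by positivity
    push_cast
    nlinarith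
  have hne : ∀ L, etaPairingState (fun _ : FermionTorus 2 L => (1 : ℤˣ)) (m L) ≠ 0 := fun L =>
    etaPairingState_ne_zero _ (hmle L)
  choose c hc0 hc1 using fun L => exists_smul_unit (hne L)
  set ψ : ∀ L, Fock (Orb (FermionTorus 2 L)) :=
    fun L => c L • etaPairingState (fun _ : FermionTorus 2 L => (1 : ℤˣ)) (m L) with hψ
  -- admissibility in the weakened sense
  have hyp : ∀ L, Even L → (fun L => 2 * m L) L = 2 * ⌊(1 - (1 / 4 : ℝ)) * (L : ℝ) ^ 2 / 2⌋₊ ∧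
      star (ψ L) ⬝ᵥ ψ L = 1 ∧ (ψ L ∈ szSector (Λ := FermionTorus 2 L) ((fun L => 2 * m L) L) 0 ∧ ψ L ≠ 0) := by
    intro L _
    exact ⟨rfl, hc1 L, Submodule.smul_mem _ _ (etaPairingState_one_mem_szSector L (m L)),
      smul_ne_zero (hc0 L) (hne L)⟩
  obtain ⟨L₀, hL₀⟩ := h 1 (1 / 4) one_pos ⟨by norm_num, by norm_num⟩ (fun L => 2 * m L) ψ hyp
    (1 / 8) (by norm_num)
  -- evaluate at the even side `L = 2 (L₀ + 1) ≥ 2`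
  haveI : NeZero (2 * (L₀ + 1)) := ⟨by omega⟩
  have hbad := hL₀ (2 * (L₀ + 1)) (even_two_mul _) (by omega)
  -- the structure factor of the normalised tower state is `2 m (L² - m + 1)`
  have heig : ((pairField sWave (2 * (L₀ + 1)))ᴴ * pairField sWave (2 * (L₀ + 1))) *ᵥ ψ (2 * (L₀ + 1)) =
      ((2 * (m (2 * (L₀ + 1)) : ℝ) * (((2 * (L₀ + 1) : ℕ) : ℝ) ^ 2 - m (2 * (L₀ + 1)) + 1) : ℝ) : ℂ) •
        ψ (2 * (L₀ + 1)) := by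
    simp only [hψ]
    rw [mulVec_smul, pairNumber_mulVec_etaPairingState_one, smul_comm]
  have hS := re_expect_of_eigen heig (hc1 _)
  rw [hS] at hbad
  -- arithmetic: `X = L² ≥ 4`, `3X/8 - 1 ≤ m ≤ 3X/8`, but `2 m (X - m + 1) ≤ X²/8`
  set X : ℝ := (((2 * (L₀ + 1) : ℕ) : ℝ)) ^ 2 with hX
  have hX4 : 4 ≤ X := by
    have h2 : (2 : ℝ) ≤ ((2 * (L₀ + 1) : ℕ) : ℝ) := by exact_mod_cast (show 2 ≤ 2 * (L₀ + 1) by omega)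
    rw [hX]
    nlinarith
  have hx : (1 - (1 / 4 : ℝ)) * (((2 * (L₀ + 1) : ℕ) : ℝ)) ^ 2 / 2 = 3 * X / 8 := by rw [hX]; ring
  have h1 : 3 * X / 8 - 1 ≤ (m (2 * (L₀ + 1)) : ℝ) := by
    have hlt : (1 - (1 / 4 : ℝ)) * (((2 * (L₀ + 1) : ℕ) : ℝ)) ^ 2 / 2 < (m (2 * (L₀ + 1)) : ℝ) + 1 :=
      Nat.lt_floor_add_one _
    linarith
  have h2 : (m (2 * (L₀ + 1)) : ℝ) ≤ 3 * X / 8 := by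
    have hle : (m (2 * (L₀ + 1)) : ℝ) ≤ (1 - (1 / 4 : ℝ)) * (((2 * (L₀ + 1) : ℕ) : ℝ)) ^ 2 / 2 :=
      Nat.floor_le (by positivity)
    linarith
  have hX0 : (0 : ℝ) < (((2 * (L₀ + 1) : ℕ) : ℝ)) ^ 4 := by positivity
  rw [div_le_iff₀ hX0] at hbad
  have h4 : (((2 * (L₀ + 1) : ℕ) : ℝ)) ^ 4 = X ^ 2 := by rw [hX]; ring
  rw [h4] at hbad
  have := witness_arith hX4 h1 h2
  linarith

end Summit.HubbardSuperconductivity.HubbardSuperconductivity.Theorems.NoOnsiteODLRO.Negative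

end
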